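import Literature.MathematicalPhysics.QuantumFieldTheory.Balaban1983to89.Node00.Record11

/-!
# NODE 00 (YM-PLAN Track A) — THE β OF RECORD AT STAGE 11 BY NAME (`betaOfRecord₁₁`), its merged β ∕ one-loop numbers ∕ printed split of record,
# and THE β-SIDE BINDERS READ OVER `IsRecordOfRecord₁₁C` (the `BetaBoundsInInterval` ∕ `FlowStep` box predicates at the record's OWN objects)

NODE 00 β-SIDE DEFINER MODULE (seat `pub-ymgap-node00-def-B`, gen 3; director-ym R134 (c): «the `BetaBoundsInInterval` ∕ FlowStep β binder over ₁₁C that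
LINE №45 (2) found unbookable over ₉C, + `betaOfRecord₁₁` instances for N24 ∕ N26»).  ONE importing module over seat node00-def-T's `Node00/Record11.lean`
(`IsRecordOfRecord₁₁C`, `datumOfRecord₁₁`, `βfun_datumOfRecord₁₁`); nothing upstream is edited or restated; namespace `…Balaban1983to89.Node00`.

WHY.  LINE №45 (2) (pub-ymgap INBOX l.10932): at Stage 9 `βfun = betaOfRecord₉ = betaOfRecord₈ ∘ toStage8Params` read the inputs `A_{k+1}` of [I] (1.20)–(1.22)
through the Stage-5 Radon–Nikodym REPRESENTATIVE transport and the `RkOfRecord`-keyed χ, so NO β-side binder (N25 B3 ∕ N26 B4 ∕ N28 B6 ∕ (D1) ∕ (D4)) was bookable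
over `IsRecordOfRecord₉C` (RIDER №6: point values of a representative are not determined; χ flow-dependent).  Seat node00-def-T's `Record10` ∕ `Record11` carry
the REPAIR OF RECORD: `βfun := betaOfRecord₁₀ θ.toStage9Params = betaOfRecord₉c` — β over the CONTINUOUS-VERSION transport `TcOfRecord` (point values determined
by the a.e.-class under the record's proviso `contT`, `Record11.exists_betaVersion_of_isRecordOfRecord₁₁C`) and def-χ's flow-blind `chiFixed7`.  What was missing
at ₁₁ is the NAME LAYER the β-side consumers knit against (FAN-OUT v1.1 «Definitions waited on: β binder over ₁₁C» — N24 s2, N26 s2, N28 s2, N17 β-face):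
this file supplies it, and nothing else.

WHAT IS HERE (definitions by `abbrev` ∕ `def` over landed objects; faces `rfl` or one-liners over landed theorems; 0 `sorry`; standard axioms):
* §1 THE OBJECTS BY NAME at `θ : Stage11Params`: `betaMergedOfRecord₁₁ θ` — the MERGED β (1.22) of the merged new term (1.6) over `(TcOfRecord, chiFixed7 θ.ν, εbg)`
  in the β-layer's chart `(ρ8, bV)` (dag-n09-b's `betaMerged`, seat def-T's `mergedTermFamilyMatT`); `beta0OfRecord₁₁ θ` — the ONE-LOOP NUMBERS `β⁰_{k+1}` read at
  the base histories `θ.v₀` (`beta0OfMerged`, chair R434 (c3)'s `limUnder` reading; NO existence ∕ positivity asserted — NODE O's); `betaOfRecord₁₁ θ := betaOfRecord₁₀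
  θ.toStage9Params` (reducible; `= betaOfRecord₉c = betaOfRecord₈c ∘ toStage8Params = betaOfRecord₈T (TcOfRecord) ∘ toStage8Params = betaOfMerged (betaMergedOfRecord₁₁ θ)
  (beta0OfRecord₁₁ θ) θ.γ`, all `rfl`); the printed one-loop split OF RECORD `oneLoopSplitOfRecord₁₁ θ` (`oneLoopSplit_betaOfMerged`, its `β0` IS `beta0OfRecord₁₁ θ`);
  the values ON the box `]0, θ.γ]^{k+1}` (= merged β) and OFF it (= `β⁰`).
* §2 FACES AT THE DATUM ∕ RECORD: `(datumOfRecord₁₁ θ h).βfun = betaOfRecord₁₁ θ` (`rfl`), the run flows `genFlow (betaOfRecord₁₁ θ) g₀` (`rfl`), the dictionary clauses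
  `CurriesHBeta` ∕ `ForwardGenerated` of the datum AT THE NAME (the datum's own fields `curries` ∕ `fwd`), and the record-level face: a Stage-11 record presents
  `θ` with `D.βfun = betaOfRecord₁₁ θ`, the window `0 < w.γ ≤ θ.γ` and the β-version proviso `HasContTransportAlong`.
* §3 THE β-SIDE BINDERS READ AT ₁₁ (what B3's window ∕ B4 SAY about the record's own objects): on every box `]0, γ']^{k+1}` with `γ' ≤ θ.γ` the β of record AGREES with
  the merged β (`betaOfRecord₁₁_eqOn_box`), hence `BetaLowerH` ∕ `BetaUpperH` ∕ `BetaContH` on such a box for `betaOfRecord₁₁ θ` ARE the same predicates of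
  `betaMergedOfRecord₁₁ θ` (three `iff`s); the window binder `DagBinding.BetaBoundsInInterval (datumOfRecord₁₁ θ h).C.toB12 γ₀ b β⁺` (N24's `hβ`) from box bounds on
  `betaOfRecord₁₁ θ` (any `γ₀`) or on the merged β (`γ₀ ≤ θ.γ`), and OVER THE RECORD: `betaBoundsInInterval_of_isRecordOfRecord₁₁C_of_merged` — the θ-keyed merged-β box
  bounds on the binding world's own box `]0, w.γ]` give `BetaBoundsInInterval D.C.toB12 w.γ b β⁺` for every Stage-11 record `(D, w)`.
* §4 WHAT THE BINDERS BUY AT THE DATUM (bookkeeping over `DagBinding.endpointExistence_of_forwardGenerated` ∕ `T4Continuum.endpointExistence_of_betaPertHyp` at §2's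
  `ForwardGenerated` face): the endpoint-existence half of [I] Theorem 2 for `(datumOfRecord₁₁ θ h).C` from (B4 + sign + upper bound) on a box — on `betaOfRecord₁₁ θ`,
  or on the merged β with `γ' ≤ θ.γ` — or from B3's literal package `BetaPertHyp (betaOfRecord₁₁ θ)`.  Hypotheses DISPLAYED, never asserted.
NOT TYPED (located): node-specific corollaries (N24's knit, N26's literal from the (D4) socket, N28's side conditions, N17's β read-out — their seats' rows, BY NAME
over this file); JUNCTION J-11 of ym-nodeO-ideate P3 g25 (pub-ymgap INBOX l.11961: no declaration identifies the §2 [III] terms that `HasSect2FormAE` binds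
existentially with the merged term family `mergedTermFamilyMatT … (TcOfRecord …) (chiFixed7 θ.ν) θ.εbg` the β of record reads — a PIN for a successor, not a face).
VACUITY ∕ A1 (LINE №45 (3), RIDER №7): every theorem below is a per-parameter ∕ per-record implication, N-generic (`[NeZero N]`); K0 at ₁₁ is the route's item
(`Record11Inhabited`, `F 2`) and is NOT claimed; a ∀-form over ₁₁C is NOT-A-DISCHARGE.
HONEST FRAMING: definitions of record + kernel bookkeeping BY NAME; no estimate; nothing of Bałaban's β asserted (no bound, sign, continuity, limit existence or
`β⁰ > 0`); counts unmoved; one finite four-torus programme at fixed `ε` per run — NOT the continuum limit, NOT ℝ⁴, NOT OS, NOT a mass gap, NOT Clay.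
Sources: T. Bałaban, CMP **109** (1987) 249–301 [Balaban1987RG1]: (0.13) p. 254, (0.17)–(0.20) pp. 255–256, Thm 2 p. 259, (1.6) p. 261, (1.20)–(1.22) p. 264,
(2.12)–(2.14) p. 268; CMP **122** (1989) 355–392 [Balaban1989LargeFieldII]: Thm 1 + (0.1) pp. 355–356 (the end statement the window binder feeds).
-/

noncomputable section

open scoped Matrix.Norms.L2Operator

namespace Literature.MathematicalPhysics.QuantumFieldTheory.Balaban1983to89.Node00

open T4Continuum FlowStep FlowStepRuns DagBinding T4DatumAssembly

variable (F : T4Family) (N : ℕ) [NeZero N]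

/-! ## §1. The β of record at Stage 11 and its merged β ∕ one-loop numbers ∕ printed split, BY NAME -/

/-- **THE MERGED β OF RECORD at Stage-11 parameters**: [Balaban1987RG1] (1.22) — the second moment of the polarisation of the limiting kernel — of the MERGED new
term (1.6) `𝓝_{k+1}` with every input `A_{k+1}` read through the continuous-version transport `TcOfRecord`, def-χ's fixed-threshold `chiFixed7 θ.ν` and the
background regularity radius `θ.εbg`, in the β-layer's chart `(θ.ρ8, θ.bV)` (dag-n09-b's `betaMerged` on seat def-T's `mergedTermFamilyMatT`; reducible). [cite: Balaban1987RG1, (1.22) p.264 and (1.6) p.261] -/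
abbrev betaMergedOfRecord₁₁ (θ : Stage11Params F N) : HBeta :=
  letI := θ.instVβ₁; letI := θ.instVβ₂; letI := θ.instιβ
  betaMerged F (mergedTermFamilyMatT F N (TcOfRecord F N) (chiFixed7 F N θ.ν) θ.εbg) θ.ρ8 θ.bV

/-- **THE ONE-LOOP NUMBERS OF RECORD `β⁰_{k+1}` at Stage-11 parameters**: the `g_k → 0⁺` reading (`beta0OfMerged`, chair R434 (c3)'s `limUnder`) of the merged β of record at
the base histories `θ.v₀` — junk unless the one-sided limit exists; existence, history-independence and positivity (AF-0) are NODE O's statements, never asserted here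
(reducible). [cite: Balaban1987RG1, (2.12)–(2.14) p.268 and (1.22) p.264] -/
abbrev beta0OfRecord₁₁ (θ : Stage11Params F N) : ℕ → ℝ :=
  beta0OfMerged (betaMergedOfRecord₁₁ F N θ) θ.v₀

/-- **THE β-FUNCTIONS OF RECORD AT STAGE 11, BY NAME**: `betaOfRecord₁₀` of the Stage-9 part — the term seat def-T's `Record11` carries as `βfun`
(`βfun_datumOfRecord₁₁`); reducible, so every landed reading of `betaOfRecord₁₀ ∕ ₉c` applies verbatim. [cite: Balaban1987RG1, (1.20)–(1.22) p.264] -/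
abbrev betaOfRecord₁₁ (θ : Stage11Params F N) : HBeta :=
  betaOfRecord₁₀ F N θ.toStage9Params

/-- `betaOfRecord₁₁ θ = betaOfRecord₉c θ.toStage9Params` (`rfl`; seat def-T's FILE 4 name). [cite: Balaban1987RG1, (1.20)–(1.22) p.264 (bookkeeping)] -/
theorem betaOfRecord₁₁_eq_betaOfRecord₉c (θ : Stage11Params F N) : betaOfRecord₁₁ F N θ = betaOfRecord₉c F N θ.toStage9Params := rfl

/-- `betaOfRecord₁₁ θ = betaOfRecord₈c θ.toStage8Params` (`rfl`). [cite: Balaban1987RG1, (1.20)–(1.22) p.264 (bookkeeping)] -/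
theorem betaOfRecord₁₁_eq_betaOfRecord₈c (θ : Stage11Params F N) : betaOfRecord₁₁ F N θ = betaOfRecord₈c F N θ.toStage8Params := rfl

/-- `betaOfRecord₁₁ θ = betaOfRecord₈T (TcOfRecord) θ.toStage8Params` (`rfl`) — the transport-generic form N24's module 18 (`N24_betaLowerH_iff_mergedT`) and N26's
transport-generic companions read. [cite: Balaban1987RG1, (1.20)–(1.22) p.264 (bookkeeping)] -/
theorem betaOfRecord₁₁_eq_betaOfRecord₈T (θ : Stage11Params F N) :
    betaOfRecord₁₁ F N θ = betaOfRecord₈T F N (TcOfRecord F N) θ.toStage8Params := rfl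

/-- **THE SPLIT-COMPATIBLE CONVENTION OF RECORD, BY NAME**: `betaOfRecord₁₁ θ = betaOfMerged (betaMergedOfRecord₁₁ θ) (beta0OfRecord₁₁ θ) θ.γ` (`rfl`) — equal to the
merged β ON the box `]0, θ.γ]^{k+1}`, to the one-loop number OFF it. [cite: Balaban1987RG1, (1.22) p.264 and (2.12)–(2.14) p.268 (bookkeeping)] -/
theorem betaOfRecord₁₁_eq_betaOfMerged (θ : Stage11Params F N) :
    betaOfRecord₁₁ F N θ = betaOfMerged (betaMergedOfRecord₁₁ F N θ) (beta0OfRecord₁₁ F N θ) θ.γ := rfl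

variable {F N} in
/-- ON the box of record the β of record IS the merged β. [cite: Balaban1987RG1, (1.22) p.264 (bookkeeping)] -/
theorem betaOfRecord₁₁_of_mem (θ : Stage11Params F N) {k : ℕ} {v : Fin (k + 1) → ℝ} (hv : v ∈ Box θ.γ k) :
    betaOfRecord₁₁ F N θ k v = betaMergedOfRecord₁₁ F N θ k v :=
  betaOfMerged_of_mem _ _ _ hv

variable {F N} in
/-- OFF the box of record the β of record IS the one-loop number of record. [cite: Balaban1987RG1, (2.12)–(2.14) p.268 (bookkeeping)] -/
theorem betaOfRecord₁₁_of_notMem (θ : Stage11Params F N) {k : ℕ} {v : Fin (k + 1) → ℝ} (hv : v ∉ Box θ.γ k) :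
    betaOfRecord₁₁ F N θ k v = beta0OfRecord₁₁ F N θ k :=
  betaOfMerged_of_notMem _ _ _ hv

/-- **THE PRINTED ONE-LOOP SPLIT OF RECORD at Stage 11** — `β = β⁰ + β¹`, `β¹` vanishing at `g_k = 0` — carried BY CONSTRUCTION (`oneLoopSplit_betaOfMerged`) with the
NON-TRIVIAL one-loop number `beta0OfRecord₁₁ θ`; the structure, not the estimate `β⁰ > 0` (NODE O's). [cite: Balaban1987RG1, (2.12)–(2.14) p.268 and (1.22) p.264 (the printed split; bookkeeping)] -/
def oneLoopSplitOfRecord₁₁ (θ : Stage11Params F N) : B12Beta.OneLoopSplit (betaOfRecord₁₁ F N θ) :=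
  oneLoopSplit_betaOfMerged (betaMergedOfRecord₁₁ F N θ) (beta0OfRecord₁₁ F N θ) θ.γ

/-- The split's one-loop field IS `beta0OfRecord₁₁ θ` (`rfl`) — the numbers every `OneLoopSplit`-consumer (N25 ∕ N28 ∕ NODE O roads) reads at a Stage-11 record.
[cite: Balaban1987RG1, (2.12)–(2.14) p.268 (bookkeeping)] -/
theorem oneLoopSplitOfRecord₁₁_β0 (θ : Stage11Params F N) : (oneLoopSplitOfRecord₁₁ F N θ).β0 = beta0OfRecord₁₁ F N θ := rfl

/-! ## §2. Faces at the Stage-11 datum and record -/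

/-- FACE β AT THE NAME = seat def-T's `Record11.βfun_datumOfRecord₁₁` READ AT THE MINTED NAME (the proof term IS that theorem: `betaOfRecord₁₁` is the
reducible name of its right-hand side — a re-key, not a copy; dag-lead DEDUP l.12115).  The `_eq_stage10` faces of the N17 ∕ N26 lanes are theirs and cited,
not restated. [cite: Balaban1987RG1, (1.20)–(1.22) p.264 (bookkeeping)] -/
theorem βfun_datumOfRecord₁₁_eq_betaOfRecord₁₁ (θ : Stage11Params F N) (h : θ.Provisos₁₁) :
    (datumOfRecord₁₁ F N θ h).βfun = betaOfRecord₁₁ F N θ :=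
  βfun_datumOfRecord₁₁ F N θ h

/-- … unfolded to the split-compatible convention over the merged β of record (`rfl`). [cite: Balaban1987RG1, (1.22) p.264 and (2.12)–(2.14) p.268 (bookkeeping)] -/
theorem βfun_datumOfRecord₁₁_eq_betaOfMerged (θ : Stage11Params F N) (h : θ.Provisos₁₁) :
    (datumOfRecord₁₁ F N θ h).βfun = betaOfMerged (betaMergedOfRecord₁₁ F N θ) (beta0OfRecord₁₁ F N θ) θ.γ := rfl

/-- FACE flow: every run of the Stage-11 datum is generated FORWARD by (0.20) with `betaOfRecord₁₁ θ` from its bare coupling (`rfl`). [cite: Balaban1987RG1, (0.17)–(0.20) pp.255–256 (bookkeeping)] -/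
theorem flow_datumOfRecord₁₁ (θ : Stage11Params F N) (h : θ.Provisos₁₁) (p : B12.RunParams) :
    ((datumOfRecord₁₁ F N θ h).C p).flow = genFlow (betaOfRecord₁₁ F N θ) p.g0 := rfl

/-- The dictionary clause AT THE NAME: the runs' β-functions are `betaOfRecord₁₁ θ` curried at the runs' earlier couplings (the datum's own field `curries`).
[cite: Balaban1987RG1, (1.22) p.264 (bookkeeping)] -/
theorem curriesHBeta_datumOfRecord₁₁ (θ : Stage11Params F N) (h : θ.Provisos₁₁) :
    CurriesHBeta (datumOfRecord₁₁ F N θ h).C.toB12 (betaOfRecord₁₁ F N θ) :=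
  (datumOfRecord₁₁ F N θ h).curries

/-- FORWARD GENERATION AT THE NAME: the Stage-11 datum's construction is forward-generated by `betaOfRecord₁₁ θ` (the datum's own field `fwd`) — the hypothesis
`hgen` of `DagBinding.endpointExistence_of_forwardGenerated` ∕ `T4Continuum.endpointExistence_of_betaPertHyp`. [cite: Balaban1987RG1, (0.17)–(0.20) pp.255–256 (bookkeeping)] -/
theorem forwardGenerated_datumOfRecord₁₁ (θ : Stage11Params F N) (h : θ.Provisos₁₁) :
    ForwardGenerated (datumOfRecord₁₁ F N θ h).C.toB12 (betaOfRecord₁₁ F N θ) :=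
  (datumOfRecord₁₁ F N θ h).fwd

variable {F N} in
/-- **A STAGE-11 RECORD PRESENTS ITS β BY NAME, WITH ITS WINDOW AND ITS β-VERSION PROVISO**: `D = datumOfRecord₁₁ θ hP`, `D.βfun = betaOfRecord₁₁ θ`, the binding
world's box sits inside the box of record (`0 < w.γ ≤ θ.γ` — on `]0, w.γ]^{k+1}` the β of record IS the merged β, §3), and every β-input has a continuous transform
of record (`HasContTransportAlong`, from `Provisos₁₁`). [cite: Balaban1987RG1, (1.20)–(1.22) p.264 and (0.13) p.254 (bookkeeping)] -/
theorem exists_betaOfRecord₁₁_of_isRecordOfRecord₁₁C {D : FiniteEpsData F (SU N)} {w : WorldP} (h : IsRecordOfRecord₁₁C F N D w) :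
    ∃ (θ : Stage11Params F N) (hP : θ.Provisos₁₁), θ.Admissible ∧ D = datumOfRecord₁₁ F N θ hP ∧ D.βfun = betaOfRecord₁₁ F N θ ∧
      (0 < w.γ ∧ w.γ ≤ θ.γ) ∧ θ.toStage8Params.HasContTransportAlong := by
  obtain ⟨θ, hP, hθ, rfl, -, hγ, -⟩ := h
  exact ⟨θ, hP, hθ, rfl, rfl, hγ, hP.hasContTransportAlong⟩

/-! ## §3. The β-side binders read at Stage 11: box predicates of `betaOfRecord₁₁` vs the merged β, and the window binder `BetaBoundsInInterval` -/

variable {F N}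

/-- **ON EVERY BOX INSIDE THE BOX OF RECORD THE β OF RECORD AGREES WITH THE MERGED β**: `γ' ≤ θ.γ ⇒ betaOfRecord₁₁ θ k = betaMergedOfRecord₁₁ θ k` on `]0, γ']^{k+1}`
(`betaOfMerged_of_mem`, `FlowStep.box_mono`). [cite: Balaban1987RG1, (1.22) p.264 and (2.12)–(2.14) p.268 (bookkeeping)] -/
theorem betaOfRecord₁₁_eqOn_box (θ : Stage11Params F N) {γ' : ℝ} (hγ' : γ' ≤ θ.γ) (k : ℕ) :
    Set.EqOn (betaOfRecord₁₁ F N θ k) (betaMergedOfRecord₁₁ F N θ k) (Box γ' k) :=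
  fun _ hv => betaOfRecord₁₁_of_mem θ (box_mono hγ' k hv)

/-- **B3's LOWER window bound read at ₁₁**: for `γ' ≤ θ.γ`, `b ≤ betaOfRecord₁₁ θ` on the boxes `]0, γ']^{k+1}` IFF the same for the merged β of record — the content of
N24 module 18's transport-generic `N24GlueStage10C.N24_betaLowerH_iff_mergedT` at `T := TcOfRecord`, stated AT THE MINTED NAMES without N24's import cone (so the N26 ∕ N28 ∕ N17
lanes read it over `Record11` alone).  Lower bound with `b > 0`: UNPRINTED (T09.F = NODE O). [cite: Balaban1987RG1, Thm 2 p.259 and §1 (1.22) p.264 (bookkeeping)] -/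
theorem betaLowerH_betaOfRecord₁₁_iff (θ : Stage11Params F N) {γ' b : ℝ} (hγ' : γ' ≤ θ.γ) :
    BetaLowerH b γ' (betaOfRecord₁₁ F N θ) ↔ BetaLowerH b γ' (betaMergedOfRecord₁₁ F N θ) := by
  refine ⟨fun h k v hv => ?_, fun h k v hv => ?_⟩
  · rw [← betaOfRecord₁₁_eqOn_box θ hγ' k hv]; exact h k v hv
  · rw [betaOfRecord₁₁_eqOn_box θ hγ' k hv]; exact h k v hv

/-- **B3's UPPER window bound read at ₁₁**: for `γ' ≤ θ.γ`, `betaOfRecord₁₁ θ ≤ β'` on the boxes `]0, γ']^{k+1}` IFF the same for the merged β of record (content of module 18's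
`N24_betaUpperH_iff_mergedT` at `T := TcOfRecord`, at the minted names; p. 264 «uniformly bounded on this interval», proof deferred in print). [cite: Balaban1987RG1, §1 (1.22) p.264 (bookkeeping)] -/
theorem betaUpperH_betaOfRecord₁₁_iff (θ : Stage11Params F N) {γ' β' : ℝ} (hγ' : γ' ≤ θ.γ) :
    BetaUpperH β' γ' (betaOfRecord₁₁ F N θ) ↔ BetaUpperH β' γ' (betaMergedOfRecord₁₁ F N θ) := by
  refine ⟨fun h k v hv => ?_, fun h k v hv => ?_⟩
  · rw [← betaOfRecord₁₁_eqOn_box θ hγ' k hv]; exact h k v hv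
  · rw [betaOfRecord₁₁_eqOn_box θ hγ' k hv]; exact h k v hv

/-- **B4 read at ₁₁** (N26's binder `BetaContH γc D.βfun` at the datum's β, at the name): for `γc ≤ θ.γ`, joint history-continuity of `betaOfRecord₁₁ θ` on the boxes
`]0, γc]^{k+1}` IFF per-`k` continuity of the merged β of record there (continuity on a set is invariant under agreement on the set) — the Literature-side, θ-keyed content
of dag-n26-a's `Summit….BalabanUVNodesN26AtBetaC.betaContH_betaOfRecord₉c_iff` ∕ dag-n26-c's `…N26AtRecord11.betaContH_datumOfRecord₁₁_iff` (Summit-side, not importable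
here). [cite: Balaban1987RG1, §1 p.263–264 and (1.22) p.264 (bookkeeping)] -/
theorem betaContH_betaOfRecord₁₁_iff (θ : Stage11Params F N) {γc : ℝ} (hγc : γc ≤ θ.γ) :
    BetaContH γc (betaOfRecord₁₁ F N θ) ↔ ∀ k, ContinuousOn (betaMergedOfRecord₁₁ F N θ k) (Box γc k) :=
  forall_congr' fun k =>
    ⟨fun h => h.congr fun _ hv => (betaOfRecord₁₁_eqOn_box θ hγc k hv).symm, fun h => h.congr (betaOfRecord₁₁_eqOn_box θ hγc k)⟩

variable (F N) in
/-- **THE WINDOW BINDER AT THE STAGE-11 DATUM from box bounds on the β of record**: `b ≤ betaOfRecord₁₁ θ ≤ β⁺` on `]0, γ₀]^{k+1}` (any `γ₀`) give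
`BetaBoundsInInterval (datumOfRecord₁₁ θ h).C.toB12 γ₀ b β⁺` — N24's `hβ` — through the dictionary clause (`DagBinding.betaBoundsInInterval_of_boxBounds` at `curries`).
[cite: Balaban1987RG1, §1 (1.22) p.264; Balaban1989LargeFieldII, Thm 1 p.355 (the binder's consumer; bookkeeping)] -/
theorem betaBoundsInInterval_datumOfRecord₁₁_of_boxBounds (θ : Stage11Params F N) (h : θ.Provisos₁₁) {γ₀ b βup : ℝ}
    (hlo : BetaLowerH b γ₀ (betaOfRecord₁₁ F N θ)) (hhi : BetaUpperH βup γ₀ (betaOfRecord₁₁ F N θ)) :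
    BetaBoundsInInterval (datumOfRecord₁₁ F N θ h).C.toB12 γ₀ b βup :=
  DagBinding.betaBoundsInInterval_of_boxBounds _ _ (curriesHBeta_datumOfRecord₁₁ F N θ h) hlo hhi

variable (F N) in
/-- **THE WINDOW BINDER AT THE STAGE-11 DATUM from box bounds on the MERGED β of record** on a window inside the box of record (`γ₀ ≤ θ.γ`; §3's two `iff`s).
[cite: Balaban1987RG1, §1 (1.22) p.264 and (2.12)–(2.14) p.268; Balaban1989LargeFieldII, Thm 1 p.355 (bookkeeping)] -/
theorem betaBoundsInInterval_datumOfRecord₁₁_of_merged (θ : Stage11Params F N) (h : θ.Provisos₁₁) {γ₀ b βup : ℝ} (hγ₀ : γ₀ ≤ θ.γ)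
    (hlo : BetaLowerH b γ₀ (betaMergedOfRecord₁₁ F N θ)) (hhi : BetaUpperH βup γ₀ (betaMergedOfRecord₁₁ F N θ)) :
    BetaBoundsInInterval (datumOfRecord₁₁ F N θ h).C.toB12 γ₀ b βup :=
  betaBoundsInInterval_datumOfRecord₁₁_of_boxBounds F N θ h ((betaLowerH_betaOfRecord₁₁_iff θ hγ₀).mpr hlo)
    ((betaUpperH_betaOfRecord₁₁_iff θ hγ₀).mpr hhi)

/-- **THE WINDOW BINDER OVER THE STAGE-11 RECORD** (the `BetaBoundsInInterval` β binder over ₁₁C): if for every presentation `(θ, hP)` of the record with `w.γ ≤ θ.γ`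
the merged β of record satisfies `b ≤ β ≤ β⁺` on the binding world's OWN box `]0, w.γ]^{k+1}` — a statement about the record's own version-free objects (β over
`TcOfRecord` ∕ `chiFixed7`; lower half with `b > 0` UNPRINTED, T09.F = NODE O; upper half p. 264) — then `BetaBoundsInInterval D.C.toB12 w.γ b β⁺` (N24's `hβ` at
`γ₀ := w.γ`).  The θ-keyed hypothesis is the ₁₁ shape of N24 module 19's `hβm`. [cite: Balaban1987RG1, §1 (1.22) p.264, (2.12)–(2.14) p.268 and Thm 2 p.259; Balaban1989LargeFieldII, Thm 1 p.355 (bookkeeping over the Stage-11 record)] -/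
theorem betaBoundsInInterval_of_isRecordOfRecord₁₁C_of_merged {D : FiniteEpsData F (SU N)} {w : WorldP} (h : IsRecordOfRecord₁₁C F N D w) {b βup : ℝ}
    (hβm : ∀ (θ : Stage11Params F N) (hP : θ.Provisos₁₁), θ.Admissible → D = datumOfRecord₁₁ F N θ hP → w.γ ≤ θ.γ →
      BetaLowerH b w.γ (betaMergedOfRecord₁₁ F N θ) ∧ BetaUpperH βup w.γ (betaMergedOfRecord₁₁ F N θ)) :
    BetaBoundsInInterval D.C.toB12 w.γ b βup := by
  obtain ⟨θ, hP, hθ, rfl, -, hγ, -⟩ := h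
  obtain ⟨hlo, hhi⟩ := hβm θ hP hθ rfl hγ.2
  exact betaBoundsInInterval_datumOfRecord₁₁_of_merged F N θ hP hγ.2 hlo hhi

/-! ## §4. What the β-side binders buy at the Stage-11 datum: the endpoint-existence half of [I] Theorem 2 (bookkeeping; hypotheses displayed) -/

variable (F N)

/-- **END at the Stage-11 datum from box properties of the β of record**: `0 < γ₀`, `0 ≤ β'`, B4 `BetaContH γ₀ (betaOfRecord₁₁ θ)`, the SIGN `0 ≤ β` (UNPRINTED, T09.F) and
the upper bound `β ≤ β'` on `]0, γ₀]^{k+1}` give `EndpointExistence (datumOfRecord₁₁ θ h).C.toB12` — `DagBinding.endpointExistence_of_forwardGenerated` at §2's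
`ForwardGenerated` face.  Nothing of the three β-hypotheses is asserted. [cite: Balaban1987RG1, Thm 2 p.259 and (1.22) p.264 (bookkeeping over the tree's shooting argument)] -/
theorem endpointExistence_datumOfRecord₁₁_of_boxH (θ : Stage11Params F N) (h : θ.Provisos₁₁) {γ₀ β' : ℝ} (hγ₀ : 0 < γ₀) (hβ' : 0 ≤ β')
    (hcont : BetaContH γ₀ (betaOfRecord₁₁ F N θ)) (hsign : BetaLowerH 0 γ₀ (betaOfRecord₁₁ F N θ)) (hup : BetaUpperH β' γ₀ (betaOfRecord₁₁ F N θ)) :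
    EndpointExistence (datumOfRecord₁₁ F N θ h).C.toB12 :=
  DagBinding.endpointExistence_of_forwardGenerated _ _ hγ₀ hβ' hcont hsign hup (forwardGenerated_datumOfRecord₁₁ F N θ h)

/-- **END at the Stage-11 datum from box properties of the MERGED β of record** on a window inside the box of record (`0 < γ' ≤ θ.γ`; §3's three `iff`s) — the
(B)-free, version-free reading over the record's own objects. [cite: Balaban1987RG1, Thm 2 p.259, (1.22) p.264 and (2.12)–(2.14) p.268 (bookkeeping)] -/
theorem endpointExistence_datumOfRecord₁₁_of_mergedH (θ : Stage11Params F N) (h : θ.Provisos₁₁) {γ' β' : ℝ} (hγ' : 0 < γ' ∧ γ' ≤ θ.γ) (hβ' : 0 ≤ β')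
    (hcont : ∀ k, ContinuousOn (betaMergedOfRecord₁₁ F N θ k) (Box γ' k)) (hsign : BetaLowerH 0 γ' (betaMergedOfRecord₁₁ F N θ))
    (hup : BetaUpperH β' γ' (betaMergedOfRecord₁₁ F N θ)) : EndpointExistence (datumOfRecord₁₁ F N θ h).C.toB12 :=
  endpointExistence_datumOfRecord₁₁_of_boxH F N θ h hγ'.1 hβ' ((betaContH_betaOfRecord₁₁_iff θ hγ'.2).mpr hcont)
    ((betaLowerH_betaOfRecord₁₁_iff θ hγ'.2).mpr hsign) ((betaUpperH_betaOfRecord₁₁_iff θ hγ'.2).mpr hup)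

/-- **END at the Stage-11 datum from B3's LITERAL PACKAGE `BetaPertHyp (betaOfRecord₁₁ θ)`** (N25's binder at the datum's β, at the name):
`T4Continuum.endpointExistence_of_betaPertHyp` at §2's `ForwardGenerated` face.  B3 is NODE O's; nothing asserted. [cite: Balaban1987RG1, Thm 2 p.259 and (1.22) p.264 (bookkeeping)] -/
theorem endpointExistence_datumOfRecord₁₁_of_betaPertHyp (θ : Stage11Params F N) (h : θ.Provisos₁₁) (hB3 : BetaPertHyp (betaOfRecord₁₁ F N θ)) :
    EndpointExistence (datumOfRecord₁₁ F N θ h).C.toB12 :=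
  T4Continuum.endpointExistence_of_betaPertHyp _ _ hB3 (forwardGenerated_datumOfRecord₁₁ F N θ h)

end Literature.MathematicalPhysics.QuantumFieldTheory.Balaban1983to89.Node00

end
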